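import Literature.MeasureTheory.RestrictedProduct.ProductIntegral
import Literature.Probability.Distributions.GaussianPiDensity
import Mathlib.MeasureTheory.Integral.Pi
import Mathlib.MeasureTheory.Integral.DominatedConvergence
import HarnessLib

/-!
# Restricted product measures, IX: Euler products of factorizable functions (monotone / dominated limits)
# `∫ ∏_i φ_i(x_i) dμ = lim_S ∏_{i∈S} ∫ φ_i dν_i`

Topic `MeasureTheory/RestrictedProduct`; continues `ProductIntegral` (the CYLINDER case
`∫ 1_{A_S} ∏_{i∈S} f_i(x_i) dμ = ∏_{i∈S} ∫ f_i dν_i` for the restricted product measure `μ = rpMeasure K ν S₀`,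
Tate's thesis, Cassels–Fröhlich (1967) Ch. XV §3.3 [CasselsFrohlichANT1967]). THEOREMS ONLY (no definition,
no instance).

Tate's Theorem 3.3.1: a function `F` on the restricted product which ON EVERY BOX `A_S` (`S ⊇ S₀`) is the finite
product `∏_{i∈S} φ_i(x_i)` — i.e. `F = ∏_i φ_i` with local factors `φ_i ≡ 1` ON `K_i` off `S₀` but NOT necessarily
supported in `K_i` (the shape of unramified ORBITAL integrands `x_v ↦ 1_{K_v}(x_v⁻¹ γ x_v)`, of spherical functions,
of local zeta integrands) — has
* `setLIntegral_rpBox_eq_prod` / `setIntegral_rpBox_eq_prod`: `∫_{A_S} F dμ = ∏_{i∈S} ∫ φ_i dν_i`;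
* `lintegral_eq_iSup_prod_of_forall_rpBox`: `∫⁻ F dμ = ⨆_{S ⊇ S₀} ∏_{i∈S} ∫⁻ φ_i dν_i` (`φ_i ≥ 0`; monotone
  convergence along the boxes `A_S ↑ X`; no measurability of `F` needed, only of the `φ_i`);
* `lintegral_eq_prod_of_forall_rpBox`: if moreover `∫⁻ φ_i dν_i = 1` off a finite `S₁ ⊇ S₀`, `∫⁻ F dμ = ∏_{i∈S₁} ∫⁻ φ_i`;
* `tendsto_prod_integral_of_forall_rpBox`: for `𝕜`-valued factors and `F` INTEGRABLE,
  `∏_{i ∈ T} ∫ φ_i dν_i ⟶ ∫ F dμ` as `T ↑` (dominated convergence); `integral_eq_prod_of_forall_rpBox`: the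
  stabilised form `∫ F dμ = ∏_{i∈S₁} ∫ φ_i dν_i` when `∫ φ_i = 1` off `S₁`.
Also the `ℝ≥0∞` twin of the cylinder formula (`lintegral_indicator_rpBox_prod`; finite Tonelli from
★ `Literature.Probability.Distributions.lintegral_fin_nat_prod_eq_prod`).

## References

* J. W. S. Cassels, A. Fröhlich (eds.), *Algebraic Number Theory* (1967), Ch. XV (J. Tate, *Fourier analysis in
  number fields and Hecke's zeta-functions*), §3.3, Thm 3.3.1 [CasselsFrohlichANT1967].
* A. Borel, H. Jacquet, *Automorphic forms and automorphic representations*, PSPM 33.1 (1979), §4.1 [BorelJacquet1979].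
-/

set_option autoImplicit false

noncomputable section

open _root_.MeasureTheory Set Filter Function Topology
open scoped RestrictedProduct ENNReal NNReal

namespace Literature.MeasureTheory.RestrictedProduct

universe u v

/-! ### Tonelli for finite products of `ℝ≥0∞`-valued one-variable functions -/

section FiniteProduct

/-- Tonelli for a finite product of one-variable functions indexed by a finite type,
`∫⁻ ∏_i f_i(x_i) d(⊗_i μ_i) = ∏_i ∫⁻ f_i dμ_i`, from the tree's `Fin n` case
★ `Literature.Probability.Distributions.lintegral_fin_nat_prod_eq_prod` (`GaussianPiDensity`). A public `Fintype`
version exists as `Literature.MathematicalPhysics.QuantumFieldTheory.GaussianToolkit.lintegral_fintype_prod_eq_prod_dep`,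
whose module imports all of Mathlib and the Brownian-motion files — not a sensible import for this lineage; hence
this private copy of the four-line reindexing. [folklore] -/
private theorem lintegral_fintype_prod_eq_prod_aux {ι : Type*} [Fintype ι] {E : ι → Type*}
    [∀ i, MeasurableSpace (E i)] (μ : ∀ i, Measure (E i)) [∀ i, SigmaFinite (μ i)] {f : ∀ i, E i → ℝ≥0∞}
    (hf : ∀ i, Measurable (f i)) : ∫⁻ x, ∏ i, f i (x i) ∂(Measure.pi μ) = ∏ i, ∫⁻ x, f i x ∂(μ i) := by
  let e := (Fintype.equivFin ι).symm
  rw [← (measurePreserving_piCongrLeft _ e).lintegral_comp_emb (MeasurableEquiv.measurableEmbedding _)]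
  simp_rw [← e.prod_comp, MeasurableEquiv.coe_piCongrLeft, Equiv.piCongrLeft_apply_apply,
    Literature.Probability.Distributions.lintegral_fin_nat_prod_eq_prod _ _ (fun i => hf (e i))]

end FiniteProduct

/-! ### Euler products on the restricted product -/

variable {ι : Type u} {G : ι → Type v} [∀ i, MeasurableSpace (G i)]
variable (K : ∀ i, Set (G i)) (ν : ∀ i, Measure (G i))

variable [Countable ι] [∀ i, SigmaFinite (ν i)]

/-- **Cylinder Euler formula, `ℝ≥0∞` version**: for a finite `S ⊇ S₀` and measurable `f_i : G_i → [0, ∞]`, `i ∈ S`,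
`∫⁻ 1_{A_S}(x) ∏_{i∈S} f_i(x_i) dμ = ∏_{i∈S} ∫⁻ f_i dν_i` (`μ = rpMeasure K ν S₀`; the factors `i ∉ S` contribute
`ν_i(K_i) = 1`). [cite: CasselsFrohlichANT1967, Ch. XV (Tate) §3.3, Thm 3.3.1] -/
theorem lintegral_indicator_rpBox_prod (hKne : ∀ i, (K i).Nonempty) (hKm : ∀ i, MeasurableSet (K i))
    {S₀ : Finset ι} (hK1 : ∀ i, i ∉ S₀ → ν i (K i) = 1) {S : Finset ι} (hS : S₀ ⊆ S)
    (f : ∀ i : {i // i ∈ S}, G i → ℝ≥0∞) (hf : ∀ i, Measurable (f i)) :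
    ∫⁻ x, (rpBox K S).indicator (fun x => ∏ i : {i // i ∈ S}, f i (x i)) x ∂(rpMeasure K ν S₀) =
      ∏ i : {i // i ∈ S}, ∫⁻ y, f i y ∂(ν i) := by
  haveI : ∀ i : {i // i ∉ S}, IsProbabilityMeasure (kap K ν hKne i) :=
    fun i => isProbabilityMeasure_kap K ν hKne hKm i
  haveI := isProbabilityMeasure_rho K ν hKne hKm S
  rw [lintegral_indicator (measurableSet_rpBox K hKm S), rpMeasure_restrict_rpBox K ν hKne hKm hK1 hS,
    (measurableEmbedding_glue K hKne hKm S).lintegral_map]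
  have hglue : ∀ p : ((i : {i // i ∈ S}) → G i) × ((i : {i // i ∉ S}) → K i),
      (∏ i : {i // i ∈ S}, f i (glue K S p i)) = ∏ i : {i // i ∈ S}, f i (p.1 i) := by
    intro p
    refine Finset.prod_congr rfl fun i _ => ?_
    rw [glue_apply_of_mem K S p i.2]
  simp_rw [hglue]
  have hF : Measurable fun w : (i : {i // i ∈ S}) → G i => ∏ i : {i // i ∈ S}, f i (w i) :=
    Finset.measurable_prod _ fun i _ => (hf i).comp (measurable_pi_apply i)
  have h1 := lintegral_prod_mul (μ := Measure.pi fun i : {i // i ∈ S} => ν i) (ν := rho K ν hKne S)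
    hF.aemeasurable (aemeasurable_const (b := (1 : ℝ≥0∞)))
  simp only [mul_one, lintegral_const, measure_univ] at h1
  rw [h1, lintegral_fintype_prod_eq_prod_aux _ hf]

/-- **Box integrals of a factorizable function.** If `F : X → [0, ∞]` agrees on the box `A_S` (`S ⊇ S₀`) with the
finite product `∏_{i∈S} φ_i(x_i)` of measurable local factors, then `∫⁻_{A_S} F dμ = ∏_{i∈S} ∫⁻ φ_i dν_i`.
[cite: CasselsFrohlichANT1967, Ch. XV (Tate) §3.3, Thm 3.3.1] -/
theorem setLIntegral_rpBox_eq_prod (hKne : ∀ i, (K i).Nonempty) (hKm : ∀ i, MeasurableSet (K i))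
    {S₀ : Finset ι} (hK1 : ∀ i, i ∉ S₀ → ν i (K i) = 1) (φ : ∀ i, G i → ℝ≥0∞) (hφ : ∀ i, Measurable (φ i))
    (F : (Πʳ i, [G i, K i]) → ℝ≥0∞) {S : Finset ι} (hS : S₀ ⊆ S) (hF : ∀ x ∈ rpBox K S, F x = ∏ i ∈ S, φ i (x i)) :
    ∫⁻ x in rpBox K S, F x ∂(rpMeasure K ν S₀) = ∏ i ∈ S, ∫⁻ y, φ i y ∂(ν i) := by
  rw [← lintegral_indicator (measurableSet_rpBox K hKm S)]
  have hind : (rpBox K S).indicator F = (rpBox K S).indicator fun x => ∏ i : {i // i ∈ S}, φ i.1 (x i.1) := by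
    refine Set.indicator_congr fun x hx => ?_
    rw [hF x hx, ← Finset.prod_coe_sort S]
  rw [hind, lintegral_indicator_rpBox_prod K ν hKne hKm hK1 hS (fun i : {i // i ∈ S} => φ i.1) (fun i => hφ i.1)]
  exact Finset.prod_coe_sort S (fun i => ∫⁻ y, φ i y ∂(ν i))

/-- The same for the Bochner integral of scalar factors (no measurability or integrability needed: both sides
follow the Bochner conventions, ★ `integral_indicator_rpBox_prod`). [cite: CasselsFrohlichANT1967, Ch. XV (Tate) §3.3, Thm 3.3.1] -/
theorem setIntegral_rpBox_eq_prod (hKne : ∀ i, (K i).Nonempty) (hKm : ∀ i, MeasurableSet (K i))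
    {S₀ : Finset ι} (hK1 : ∀ i, i ∉ S₀ → ν i (K i) = 1) {𝕜 : Type*} [RCLike 𝕜] (φ : ∀ i, G i → 𝕜)
    (F : (Πʳ i, [G i, K i]) → 𝕜) {S : Finset ι} (hS : S₀ ⊆ S) (hF : ∀ x ∈ rpBox K S, F x = ∏ i ∈ S, φ i (x i)) :
    ∫ x in rpBox K S, F x ∂(rpMeasure K ν S₀) = ∏ i ∈ S, ∫ y, φ i y ∂(ν i) := by
  rw [← integral_indicator (measurableSet_rpBox K hKm S)]
  have hind : (rpBox K S).indicator F = (rpBox K S).indicator fun x => ∏ i : {i // i ∈ S}, φ i.1 (x i.1) := by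
    refine Set.indicator_congr fun x hx => ?_
    rw [hF x hx, ← Finset.prod_coe_sort S]
  rw [hind, integral_indicator_rpBox_prod K ν hKne hKm hK1 hS (fun i : {i // i ∈ S} => φ i.1)]
  exact Finset.prod_coe_sort S (fun i => ∫ y, φ i y ∂(ν i))

/-- **Tate's Theorem 3.3.1 (monotone form).** Let `F : X → [0, ∞]` on the restricted product `X = ∏'_i (G_i ; K_i)` be
FACTORIZABLE with measurable local factors `φ_i` that are `≡ 1` on `K_i` off `S₀`, in the sense that on every box
`A_S`, `S ⊇ S₀`, `F(x) = ∏_{i∈S} φ_i(x_i)` (e.g. `F(x) = ∏_i φ_i(x_i)`, a finite product for each `x`). Then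
`∫⁻ F dμ = ⨆_{S ⊇ S₀} ∏_{i∈S} ∫⁻ φ_i dν_i` — the partial products increase along `S` (monotone convergence over
`A_S ↑ X`). No measurability of `F` is required. [cite: CasselsFrohlichANT1967, Ch. XV (Tate) §3.3, Thm 3.3.1] -/
theorem lintegral_eq_iSup_prod_of_forall_rpBox (hKne : ∀ i, (K i).Nonempty) (hKm : ∀ i, MeasurableSet (K i))
    {S₀ : Finset ι} (hK1 : ∀ i, i ∉ S₀ → ν i (K i) = 1) (φ : ∀ i, G i → ℝ≥0∞) (hφ : ∀ i, Measurable (φ i))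
    (F : (Πʳ i, [G i, K i]) → ℝ≥0∞) (hF : ∀ S : Finset ι, S₀ ⊆ S → ∀ x ∈ rpBox K S, F x = ∏ i ∈ S, φ i (x i)) :
    ∫⁻ x, F x ∂(rpMeasure K ν S₀) = ⨆ (S : Finset ι) (_ : S₀ ⊆ S), ∏ i ∈ S, ∫⁻ y, φ i y ∂(ν i) := by
  classical
  -- exhaust `X` by the boxes `A_{S₀ ∪ T}`
  have hdir : Directed (· ⊆ ·) fun T : Finset ι => rpBox K (S₀ ∪ T) := fun T T' =>
    ⟨T ∪ T', rpBox_mono K (Finset.union_subset_union (le_refl S₀) Finset.subset_union_left),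
      rpBox_mono K (Finset.union_subset_union (le_refl S₀) Finset.subset_union_right)⟩
  have hbox : ∀ T : Finset ι, ∫⁻ x in rpBox K (S₀ ∪ T), F x ∂(rpMeasure K ν S₀) =
      ∏ i ∈ S₀ ∪ T, ∫⁻ y, φ i y ∂(ν i) := fun T =>
    setLIntegral_rpBox_eq_prod K ν hKne hKm hK1 φ hφ F Finset.subset_union_left (hF _ Finset.subset_union_left)
  rw [← setLIntegral_univ, ← iUnion_rpBox_union K S₀, setLIntegral_iUnion_of_directed F hdir]
  simp_rw [hbox]
  -- reindex `T ↦ S₀ ∪ T` over the supersets of `S₀`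
  refine le_antisymm (iSup_le fun T => ?_) (iSup_le fun S => iSup_le fun hS => ?_)
  · exact le_iSup₂ (f := fun (S : Finset ι) (_ : S₀ ⊆ S) => ∏ i ∈ S, ∫⁻ y, φ i y ∂(ν i)) (S₀ ∪ T)
      Finset.subset_union_left
  · have h : S₀ ∪ S = S := Finset.union_eq_right.2 hS
    calc ∏ i ∈ S, ∫⁻ y, φ i y ∂(ν i) = ∏ i ∈ S₀ ∪ S, ∫⁻ y, φ i y ∂(ν i) := by rw [h]
      _ ≤ ⨆ T : Finset ι, ∏ i ∈ S₀ ∪ T, ∫⁻ y, φ i y ∂(ν i) :=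
          le_iSup (fun T : Finset ι => ∏ i ∈ S₀ ∪ T, ∫⁻ y, φ i y ∂(ν i)) S

/-- **Tate's Theorem 3.3.1 (stabilised form).** In the situation of `lintegral_eq_iSup_prod_of_forall_rpBox`, if the
local integrals are `1` off a finite `S₁ ⊇ S₀` (`∫⁻ φ_i dν_i = 1`, `i ∉ S₁` — e.g. unramified local factors), then
`∫⁻ F dμ = ∏_{i ∈ S₁} ∫⁻ φ_i dν_i`. [cite: CasselsFrohlichANT1967, Ch. XV (Tate) §3.3, Thm 3.3.1] -/
theorem lintegral_eq_prod_of_forall_rpBox (hKne : ∀ i, (K i).Nonempty) (hKm : ∀ i, MeasurableSet (K i))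
    {S₀ : Finset ι} (hK1 : ∀ i, i ∉ S₀ → ν i (K i) = 1) (φ : ∀ i, G i → ℝ≥0∞) (hφ : ∀ i, Measurable (φ i))
    (F : (Πʳ i, [G i, K i]) → ℝ≥0∞) (hF : ∀ S : Finset ι, S₀ ⊆ S → ∀ x ∈ rpBox K S, F x = ∏ i ∈ S, φ i (x i))
    {S₁ : Finset ι} (hS₁ : S₀ ⊆ S₁) (hφ1 : ∀ i, i ∉ S₁ → ∫⁻ y, φ i y ∂(ν i) = 1) :
    ∫⁻ x, F x ∂(rpMeasure K ν S₀) = ∏ i ∈ S₁, ∫⁻ y, φ i y ∂(ν i) := by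
  classical
  have hstab : ∀ S : Finset ι, S₁ ⊆ S → ∏ i ∈ S, ∫⁻ y, φ i y ∂(ν i) = ∏ i ∈ S₁, ∫⁻ y, φ i y ∂(ν i) := by
    intro S hS
    rw [← Finset.prod_sdiff hS, Finset.prod_eq_one (fun i hi => hφ1 i (Finset.mem_sdiff.1 hi).2), one_mul]
  rw [lintegral_eq_iSup_prod_of_forall_rpBox K ν hKne hKm hK1 φ hφ F hF]
  refine le_antisymm (iSup_le fun S => iSup_le fun hS => ?_) ?_
  · -- `∏_S = ∫⁻_{A_S} F ≤ ∫⁻_{A_{S ∪ S₁}} F = ∏_{S ∪ S₁} = ∏_{S₁}`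
    have hS' : S₀ ⊆ S ∪ S₁ := hS.trans Finset.subset_union_left
    rw [← setLIntegral_rpBox_eq_prod K ν hKne hKm hK1 φ hφ F hS (hF S hS), ← hstab _ Finset.subset_union_right,
      ← setLIntegral_rpBox_eq_prod K ν hKne hKm hK1 φ hφ F hS' (hF _ hS')]
    exact lintegral_mono_set (rpBox_mono K Finset.subset_union_left)
  · exact le_iSup₂ (f := fun (S : Finset ι) (_ : S₀ ⊆ S) => ∏ i ∈ S, ∫⁻ y, φ i y ∂(ν i)) S₁ hS₁

/-- **Tate's Theorem 3.3.1 (dominated form, scalar factors).** Let `F : X → 𝕜` be INTEGRABLE for `μ = ∏'_i (ν_i ; K_i)`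
and factorizable on boxes: `F(x) = ∏_{i∈S} φ_i(x_i)` for `x ∈ A_S`, `S ⊇ S₀`. Then the partial Euler products
converge to the integral: `∏_{i ∈ T} ∫ φ_i dν_i ⟶ ∫ F dμ` as `T ↑` (`atTop` on `Finset ι`; the terms with
`T ⊉ S₀` do not matter).
[cite: CasselsFrohlichANT1967, Ch. XV (Tate) §3.3, Thm 3.3.1] -/
theorem tendsto_prod_integral_of_forall_rpBox (hKne : ∀ i, (K i).Nonempty) (hKm : ∀ i, MeasurableSet (K i))
    {S₀ : Finset ι} (hK1 : ∀ i, i ∉ S₀ → ν i (K i) = 1) {𝕜 : Type*} [RCLike 𝕜] (φ : ∀ i, G i → 𝕜)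
    (F : (Πʳ i, [G i, K i]) → 𝕜) (hF : ∀ S : Finset ι, S₀ ⊆ S → ∀ x ∈ rpBox K S, F x = ∏ i ∈ S, φ i (x i))
    (hFi : Integrable F (rpMeasure K ν S₀)) :
    Tendsto (fun T : Finset ι => ∏ i ∈ T, ∫ y, φ i y ∂(ν i)) atTop (𝓝 (∫ x, F x ∂(rpMeasure K ν S₀))) := by
  classical
  have hbox : ∀ T : Finset ι, ∫ x in rpBox K (S₀ ∪ T), F x ∂(rpMeasure K ν S₀) =
      ∏ i ∈ S₀ ∪ T, ∫ y, φ i y ∂(ν i) := fun T =>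
    setIntegral_rpBox_eq_prod K ν hKne hKm hK1 φ F Finset.subset_union_left (hF _ Finset.subset_union_left)
  have hmono : Monotone fun T : Finset ι => rpBox K (S₀ ∪ T) := fun T T' h =>
    rpBox_mono K (Finset.union_subset_union (le_refl S₀) h)
  have h := tendsto_setIntegral_of_monotone (μ := rpMeasure K ν S₀) (f := F)
    (fun T => measurableSet_rpBox K hKm (S₀ ∪ T)) hmono (by rw [iUnion_rpBox_union K S₀]; exact hFi.integrableOn)
  rw [iUnion_rpBox_union K S₀, setIntegral_univ] at h
  simp_rw [hbox] at h
  -- for `T ⊇ S₀`, `S₀ ∪ T = T`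
  refine h.congr' (eventuallyEq_of_mem (Ici_mem_atTop S₀) fun T hT => ?_)
  rw [Finset.union_eq_right.2 (Set.mem_Ici.1 hT)]

/-- **Tate's Theorem 3.3.1 (stabilised form, scalar factors).** If moreover `∫ φ_i dν_i = 1` off a finite
`S₁`, then `∫ F dμ = ∏_{i∈S₁} ∫ φ_i dν_i`. [cite: CasselsFrohlichANT1967, Ch. XV (Tate) §3.3, Thm 3.3.1] -/
theorem integral_eq_prod_of_forall_rpBox (hKne : ∀ i, (K i).Nonempty) (hKm : ∀ i, MeasurableSet (K i))
    {S₀ : Finset ι} (hK1 : ∀ i, i ∉ S₀ → ν i (K i) = 1) {𝕜 : Type*} [RCLike 𝕜] (φ : ∀ i, G i → 𝕜)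
    (F : (Πʳ i, [G i, K i]) → 𝕜) (hF : ∀ S : Finset ι, S₀ ⊆ S → ∀ x ∈ rpBox K S, F x = ∏ i ∈ S, φ i (x i))
    (hFi : Integrable F (rpMeasure K ν S₀)) {S₁ : Finset ι} (hφ1 : ∀ i, i ∉ S₁ → ∫ y, φ i y ∂(ν i) = 1) :
    ∫ x, F x ∂(rpMeasure K ν S₀) = ∏ i ∈ S₁, ∫ y, φ i y ∂(ν i) := by
  classical
  have h := tendsto_prod_integral_of_forall_rpBox K ν hKne hKm hK1 φ F hF hFi
  have hstab : ∀ T : Finset ι, S₁ ≤ T → ∏ i ∈ T, ∫ y, φ i y ∂(ν i) = ∏ i ∈ S₁, ∫ y, φ i y ∂(ν i) := by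
    intro T hT
    rw [← Finset.prod_sdiff hT, Finset.prod_eq_one (fun i hi => hφ1 i (Finset.mem_sdiff.1 hi).2), one_mul]
  have h' : Tendsto (fun T : Finset ι => ∏ i ∈ T, ∫ y, φ i y ∂(ν i)) atTop (𝓝 (∏ i ∈ S₁, ∫ y, φ i y ∂(ν i))) :=
    tendsto_const_nhds.congr' (eventuallyEq_of_mem (Ici_mem_atTop S₁) fun T hT => (hstab T hT).symm)
  exact tendsto_nhds_unique h h'

end Literature.MeasureTheory.RestrictedProduct

end
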